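import Summits.HodgeConjecture.HodgeConjecture.Theorems.F0P2cSocketC              -- ★ p01 (g3): `cohFinComponentIsThetaAdm_of_CE`, `H413_of_PK_E3flat` (⊇ ★ SocketCOfStubs, ★ CEOfRung2 + GL∕LW∕LR∕LTpu closers, ★ E3OfRung2, ★ SocketD, ★ U2′∕U1′ heads)
import Summits.HodgeConjecture.HodgeConjecture.Theorems.F0P2gPKOfRung3             -- ★ p816062 p01 (g5): `stubPK_of_PKPi` (PK ⟸ PKΠ; KSP ★ p811895, NSI ★ p813978 inside)
import Summits.HodgeConjecture.HodgeConjecture.Theorems.HCCMUnconditionalH413OfF0  -- ★ F0P4-p07: `H413_of_F0HdictE_F0HJ3a` (socket 27457 `F0Hocc` ★ p814762 discharged); imports the route file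
import HarnessLib

/-!
# Crux `H413` · programme P2 · THE FLOOR-0 SOCKET `F0HdictE` (stmt-HodgeConjecture-27455) BY ROUTE NAME FROM EXACTLY THE TWO ENGINE LETTERS PK ∕ PKΠ AND E3♭
# — the Lines-free successor of ★ `F0P2cSocketC.H413_of_PK_E3flat`, one rung up and one socket down

Cell hodgecm-mathlib (D-0151), FLOOR 0, crux item H413 = stmt-HodgeConjecture-24833 (`HCCMUnconditional.H413` ⟸ ★ `HCCMUnconditionalH413OfF0.H413_of_F0HdictE_F0HJ3a`
⟸ sockets `F0HdictE` (27455, programme P2) + `F0HJ3a` (27456, programme P3); `F0Hocc` (27457, P4) is ★ `HCCMUnconditionalF0HoccOfP4.F0Hocc_holds`).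
Author F0P2-p01 (g6) (F0P2-plan (g6) ROW «HDICTE-OF-LETTERS», GO 2026-08-31T10:22:32Z).  THEOREMS ONLY (no `def`, no instance, no notation, no named fact,
no `sorry`); kernel lane `--supports stmt-HodgeConjecture-24833 --as helper`; never imports a `Cruxes/…/Lines` module (O50-1) — the letter texts are PASTED VERBATIM.
HONEST LABEL: HC_CM is proved only modulo the printed citations until rung 0 closes; this file adds no mathematics — it is the ONE kernel term exhibiting the
ROUTE SUPPORT DECL `Summit.HodgeConjecture.HodgeConjecture.Theses.HCCMUnconditional.F0HdictE` (not merely the socket type `F0FloorSockets.HdictEType`) as a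
function of EXACTLY the open engine letters of programme P2, everything in-house plugged BY NAME.

WHY.  The (C)-line `Cruxes/H413/Lines/F0_P2CohFinComponentIsThetaC.lean` v1.3 concludes the socket by its head `F0HdictE_of_stubs : F0FloorSockets.HdictEType`
(:506) over its live `sorry`s {`stub_PK_localThetaClasses`, `stub_E3flat_automorphicParity`}; but a `Lines` module is not importable, so neither the registry
`Lines/a3_liu413.lean` (`stub_oscillatorTriple_dictionaryExistence` = socket 27455) nor the day-X closer `F0HdictE_holds` can fold through it.  Here the same
composition is a Theorems constant:

* `hdictE_of_PK_E3flat (hPK) (hE) : …Theses.HCCMUnconditional.F0HdictE` — hypotheses = the registered letter texts VERBATIM: PK = `F0P2CELocalToGlobal.StubPKLocalThetaClasses`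
  (CE sub-line v1.1 :221; = the (C)-line v1.3 :272 copy, = the conclusion of ★ `F0P2gPKOfRung3.stubPK_of_PKPi`, = the `hPK` of ★ `F0P2cSocketC.H413_of_PK_E3flat`)
  and E3♭ = `F0P2E3ParityRecut.StubE3FlatAutomorphicParity` (E3 re-cut v1.1 :127; = the (C)-line :324 copy, = the `hE` of ★ `F0P2fE3OfRung2.stubU4_of_E3flat`).
  Proof = the (C)-line's `F0HdictE_of_stubs` transcribed into ★-only currency: ★ `SpectrumInterfaces.oscillatorTriple_dictionaryExistence_holds_of` at
  U1′ := ★ `TowerRealisation.stubU1RealisationAt_holds`, U2′ := ★ p798914 `P2StubU2OfLettersCadmD.stub_U2_cohFormsSpectrumIsThetaAt_of_Cadm_D` fed the (C♭) socket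
  ★ `F0P2cSocketC.cohFinComponentIsThetaAdm_of_CE` (CL ∕ CF ∕ CI ★ inside) at CE := ★ p809975 `F0P2eCEOfRung2.stubCE_of_PK_GL_LW_LR_LTpu hPK` (GL ★ p808695, LW ★ p808696,
  LR ★ p808692, LTpu ★ p808809 by name) and the (D) socket ★ p799091 `F0P2dSocketD.holCotFormSpectralProjection_holds`, U4 := ★ `F0P2fE3OfRung2.stubU4_of_E3flat hE`
  (EB ★ p810145, EP ∕ E3fin ★ p810280 inside); the socket `def`s (`F0HdictE` := `F0FloorSockets.HdictEType`, token-identical to `SpectrumInterfaces.HdictEType`) unfold by `delta`.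
* `hdictE_of_PKPi_E3flat (hPKPi) (hE) : …F0HdictE` — the same one rung up: PKΠ = `F0P2PKRung3.StubPKPiPlacewiseMembership` (rung 3 v1.2 :176–217) = `F0P2PKPiRung4.PKPiTarget`
  (rung 4 v1.2 :146) VERBATIM (= the `hPi` of ★ p816062 and the conclusion of A-p17 (g15)'s `F0P2jPKPiOfLetters.pkPi_of_letters`), via ★ `F0P2gPKOfRung3.stubPK_of_PKPi`.
* `H413_of_PKPi_E3flat (hPKPi) (hE) (hJ3a : …Theses.HCCMUnconditional.F0HJ3a) : …Theses.HCCMUnconditional.H413` — the crux BY NAME modulo EXACTLY {PKΠ, E3♭} ∪ {socket 27456},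
  via ★ `HCCMUnconditionalH413OfF0.H413_of_F0HdictE_F0HJ3a` (27457 ★ discharged inside).
ED. 2 (foreseen, append-only): once ★ `F0P2jPKPiOfLetters.pkPi_of_letters (hS2) (hGR) (hD7) : ‹PKΠ›` is in the tree, `hdictE_of_letters (hS2 : ‹C2♯ letter›)
(hGR : GR91Lemma512NonsplitAsPrinted) (hD7 : xiEnvelope_nonsplit_isThetaType) (hE : ‹E3♭›) : …F0HdictE` — socket 27455 as ONE ★ constant modulo exactly the four P2 letters
{S2♯ (P3 export), GR91N (PRINT ★ p818501), D7α (PRINT ★ p818350), E3♭ (ENGINE (E)-row)}, each a one-token fold on day X.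

TEXT CERTIFICATES (python, whitespace-normalised exact string equality, tree bytes 2026-08-31T10:30Z; sha16 CE sub-line ad3e387e578bfc92, E3 re-cut a3adf85a083c77b9,
rung 3 4c758c8f39da70e0, rung 4 072d03abbfd41d0b, (C)-line 9a8c3ffd1210c52d): `hPK` == CE sub-line :221 == (C)-line :272 == ★ `F0P2cSocketC.H413_of_PK_E3flat`'s `hPK` ==
★ `stubPK_of_PKPi`'s conclusion; `hE` == E3 re-cut :127 == (C)-line :324 == ★ `H413_of_PK_E3flat`'s `hE`; `hPKPi` == rung 3 :176 == rung 4 `PKPiTarget` == ★ `stubPK_of_PKPi`'s `hPi` — all True.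

## References
* [Liu2021] Y. Liu, *Fourier–Jacobi cycles and arithmetic relative trace formula*, Camb. J. Math. 9 (2021): Prop. 4.13 and proof l. 2121–2146, Rem. 4.14, Def. 4.11–4.12, App. D Lem. D.1.
* [GelbartRogawski1991] S. Gelbart, J. Rogawski, Invent. Math. 105 (1991): Thm 5.1.1, Lem 5.1.2.  [Rogawski1990] Ann. of Math. Stud. 123: Thm 13.3.1, Thm 13.3.6 (c), §13.3.
* [Rogawski1992] Thm 1.1.  [HarrisKudlaSweet1996] Thm 6.1.  [Flath1979] Thm 2, Thm 3.
-/

set_option autoImplicit false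

-- the mandated namespace has the single-problem summit's repeated segment (`HodgeConjecture.HodgeConjecture`)
set_option linter.dupNamespace false

noncomputable section

namespace Summit.HodgeConjecture.HodgeConjecture.Cruxes.H413.F0P2kHdictEOfLetters

-- opens: exactly those of ★ `Theorems/F0P2cSocketC.lean` (§1 + the rung-2 letter texts), under which the pasted texts PK ∕ PKΠ ∕ E3♭ elaborate there
open NumberField MeasureTheory IsDedekindDomain
open scoped Matrix ComplexOrder
open Literature.NumberTheory.Automorphic Literature.NumberTheory.Automorphic.UnitaryGroup
open Literature.NumberTheory.Automorphic.UnitaryGroup.CotangentForms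
open Literature.NumberTheory.Automorphic.IdeleClassGroup
open Literature.NumberTheory.Automorphic.Liu2021 Literature.NumberTheory.Automorphic.Liu2021.Def411WeilCarriers
open Literature.NumberTheory.Automorphic.Liu2021.Def411WeilCarriersDoubling
open Literature.NumberTheory.GelbartRogawski1991 Literature.NumberTheory.GelbartRogawski1991.UnitaryDualPair
open Literature.RepresentationTheory.Liu2021
open Literature.NumberTheory.Rogawski1990
open Summit.HodgeConjecture.HodgeConjecture.Cruxes.H413.SpectrumInterfaces (oscillatorTriple_dictionaryExistence_holds_of)
open scoped TensorProduct
open NumberField.InfinitePlace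
open Literature.NumberTheory
open Literature.NumberTheory.GelbartRogawski1991.UnitaryDualPair.WeilCoinv
open Literature.RepresentationTheory
open Literature.NumberTheory.Automorphic.Liu2021.AppendixC
open Summit.HodgeConjecture.CorCM
open Summit.HodgeConjecture.CorCM.Transposition
open HodgeCM.Model HodgeCM.Model.LiuIndex HodgeCM.Model.TowerCarrier
open Summit.HodgeConjecture.CorCM.Model

/-! ## §1  Socket 27455 `F0HdictE` from PK and E3♭ -/

set_option synthInstance.maxHeartbeats 400000 in
set_option maxHeartbeats 16000000 in
/-- **THE ROUTE SUPPORT DECL `HCCMUnconditional.F0HdictE` (stmt-HodgeConjecture-27455) BY NAME FROM EXACTLY THE TWO RUNG-2 ENGINE LETTERS PK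
(`F0P2CELocalToGlobal.StubPKLocalThetaClasses` VERBATIM: at every finite place the local component of a cotangent-type finite component `σ` is Liu's local
theta type for local classes `ε_v`, cofinitely one class) and E3♭ (`F0P2E3ParityRecut.StubE3FlatAutomorphicParity` VERBATIM: automorphic occurrence ⇒ parity)** —
every in-house stub of programme P2 (CL, CF, CI, GL, LW, LR, LTpu, CER, EB, EP, E3fin, (D), (D̄), (C′), U1′, U2′) DISCHARGED BY NAME inside ★ files; the Lines-free
twin of the (C)-line's head `F0HdictE_of_stubs`.  HC_CM is proved only modulo the printed citations until rung 0 closes.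
[cite: Liu2021, Prop. 4.13 and proof l. 2121–2146; Rem. 4.14; Def. 4.11–4.12] [cite: GelbartRogawski1991, Thm 5.1.1, Lem 5.1.2] [cite: Rogawski1990, Thm 13.3.6 (c), §13.3]
[cite: Rogawski1992, Thm 1.1] [cite: HarrisKudlaSweet1996, Thm 6.1] [cite: Flath1979, Thm 3] -/
theorem hdictE_of_PK_E3flat
    (hPK :
      ∀ (L : Type) [Field L] [NumberField L] [IsCMField L] (ι : L →+* ℂ) (H : Matrix (Fin 3) (Fin 3) L) (T : GL (Fin 3) ℂ)
        (hT : (T : Matrix (Fin 3) (Fin 3) ℂ)ᴴ * H.map ι * (T : Matrix (Fin 3) (Fin 3) ℂ) = Literature.Geometry.ComplexHyperbolic.BallModel.J),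
        (∀ τ' : L →+* ℂ, InfinitePlace.mk τ' ≠ InfinitePlace.mk ι → (H.map τ').PosDef) → 2 ≤ Module.finrank ℚ ↥(maximalRealSubfield L) →
        ∀ {n' : ℕ} (e₁ : Fin 3 × Fin 1 ≃ Fin n') (dV : Fin 3 → L) (hdV : ∀ i, IsCMField.complexConj L (dV i) = dV i)
          (hdV0 : ∀ i, dV i ≠ 0) (g : GL (Fin 3) L)
          (hg : ((g : Matrix (Fin 3) (Fin 3) L).map (cmConjRingHom L))ᵀ * H * (g : Matrix (Fin 3) (Fin 3) L) = Matrix.diagonal dV)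
          (ιV : finAdelic (↥(maximalRealSubfield L)) L (IsCMField.complexConj L) 3 H →*
              finAdelic (↥(maximalRealSubfield L)) L (IsCMField.complexConj L) 3 (Matrix.diagonal dV)),
            (∀ k, ((ιV k : finAdelic (↥(maximalRealSubfield L)) L (IsCMField.complexConj L) 3 (Matrix.diagonal dV)) :
                GL (Fin 3) (FiniteAdeleRing (𝓞 L) L)) =
              (toFinAdeleGL L 3 g)⁻¹ * (k : GL (Fin 3) (FiniteAdeleRing (𝓞 L) L)) * toFinAdeleGL L 3 g) →
            ∀ (μ : Measure (adelicGroupData (↥(maximalRealSubfield L)) L (IsCMField.complexConj L) 3 H).automorphicQuotient)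
              [(adelicGroupData (↥(maximalRealSubfield L)) L (IsCMField.complexConj L) 3 H).IsAutomorphicMeasure μ]
              (W : Type) [AddCommGroup W] [Module ℂ W]
              (σ : Representation ℂ (finAdelic (↥(maximalRealSubfield L)) L (IsCMField.complexConj L) 3 H) W),
              σ.IsIrreducible → σ.IsSmooth → σ.IsAdmissible →
              ∀ P : DiscreteAutomorphicRep (adelicGroupData (↥(maximalRealSubfield L)) L (IsCMField.complexConj L) 3 H) μ,
                (P.IsHolCotangentAt (cmArchSection L ι H T hT) (cmCompactFactor L ι H T hT) ∨
                  P.IsAntiholCotangentAt (cmArchSection L ι H T hT) (cmCompactFactor L ι H T hT)) →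
                P.HasFinComponent σ →
                ∃ (μ : Literature.NumberTheory.Automorphic.IdeleClassGroup L →ₜ* Circle) (hμ : IsConjugateSymplectic L μ), HasWeight L μ 1 ∧
                  ∃ (χ : Chi (↥(maximalRealSubfield L)) L (IsCMField.complexConj L))
                    (ε : HeightOneSpectrum (𝓞 ↥(maximalRealSubfield L)) → (↥(maximalRealSubfield L))ˣ) (a₀ : (↥(maximalRealSubfield L))ˣ),
                    (∀ᶠ v in Filter.cofinite, locF (↥(maximalRealSubfield L)) (imagUnitSq L) (ε v) v = locF (↥(maximalRealSubfield L)) (imagUnitSq L) a₀ v) ∧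
                      ∀ (v : HeightOneSpectrum (𝓞 ↥(maximalRealSubfield L))),
                        isotypicComponent (MonoidAlgebra ℂ (localPi L (IsCMField.complexConj L) 3 H v))
                          (Representation.asModule (σ.comp (inclPlace (↥(maximalRealSubfield L)) L (IsCMField.complexConj L) 3 H v)))
                          (Representation.asModule
                            (((show Representation ℂ (localPi L (IsCMField.complexConj L) 3 (Matrix.diagonal dV) v) _ from
                              (TwistedCoinv.rep (localCharOfCenter (↥(maximalRealSubfield L)) L (IsCMField.complexConj L)
                                  (JW (↥(maximalRealSubfield L)) L (ε v)) (JW_apply_ne_zero (↥(maximalRealSubfield L)) L (ε v)) χ.1 v)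
                                ((OmegaChiSplitting.chiLocalSplittingsD ⟨L⟩ e₁ dV hdV hdV0 (toHeckeCharacter L μ)
                                  ((isOscillatorChar_toHeckeCharacter_iff μ).mpr hμ) (ε v)).omegaLoc v)
                                (commute_omegaLoc_localCenter (↥(maximalRealSubfield L)) L (IsCMField.complexConj L) 3 e₁ (Matrix.diagonal dV)
                                  (JW (↥(maximalRealSubfield L)) L (ε v)) (complexConj_imagUnit L) (imagUnit_ne_zero L) (imagUnit_mul_self L)
                                  (realDiagonal_isSymm L dV hdV) (isSymm_TW (↥(maximalRealSubfield L)) (ε v)) (realDiagonal_map L dV hdV).symm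
                                  (JW_eq (↥(maximalRealSubfield L)) L (ε v)) (JW_apply_ne_zero (↥(maximalRealSubfield L)) L (ε v))
                                  (OmegaChiSplitting.chiLocalSplittingsD ⟨L⟩ e₁ dV hdV hdV0 (toHeckeCharacter L μ)
                                    ((isOscillatorChar_toHeckeCharacter_iff μ).mpr hμ) (ε v)) v)).comp
                                (UnitaryGroup.localLineInl L (IsCMField.complexConj L) 3 e₁ (Matrix.diagonal dV) (JW (↥(maximalRealSubfield L)) L (ε v)) v)) :
                                localPi L (IsCMField.complexConj L) 3 (Matrix.diagonal dV) v →* _).comp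
                              (localCongr L (IsCMField.complexConj L) g one_ne_zero
                                (F0P2cOmegaLocalType.formCongr_frame L H dV g hg) v).symm.toMulEquiv.toMonoidHom)) = ⊤
    )
    (hE :
      ∀ (L : Type) [Field L] [NumberField L] [IsCMField L] (ι : L →+* ℂ) (H : Matrix (Fin 3) (Fin 3) L) (T : GL (Fin 3) ℂ)
        (hT : (T : Matrix (Fin 3) (Fin 3) ℂ)ᴴ * H.map ι * (T : Matrix (Fin 3) (Fin 3) ℂ) = Literature.Geometry.ComplexHyperbolic.BallModel.J),
        (∀ τ' : L →+* ℂ, InfinitePlace.mk τ' ≠ InfinitePlace.mk ι → (H.map τ').PosDef) → 2 ≤ Module.finrank ℚ ↥(maximalRealSubfield L) →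
        ∀ {n' : ℕ} (e₁ : Fin 3 × Fin 1 ≃ Fin n') (dV : Fin 3 → L) (hdV : ∀ i, IsCMField.complexConj L (dV i) = dV i)
          (hdV0 : ∀ i, dV i ≠ 0) (g : GL (Fin 3) L)
          (hg : ((g : Matrix (Fin 3) (Fin 3) L).map (cmConjRingHom L))ᵀ * H * (g : Matrix (Fin 3) (Fin 3) L) = Matrix.diagonal dV)
          (ιV : finAdelic (↥(maximalRealSubfield L)) L (IsCMField.complexConj L) 3 H →*
              finAdelic (↥(maximalRealSubfield L)) L (IsCMField.complexConj L) 3 (Matrix.diagonal dV)),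
            (∀ k, ((ιV k : finAdelic (↥(maximalRealSubfield L)) L (IsCMField.complexConj L) 3 (Matrix.diagonal dV)) :
                GL (Fin 3) (FiniteAdeleRing (𝓞 L) L)) =
              (toFinAdeleGL L 3 g)⁻¹ * (k : GL (Fin 3) (FiniteAdeleRing (𝓞 L) L)) * toFinAdeleGL L 3 g) →
            ∀ (μA : Measure (adelicGroupData (↥(maximalRealSubfield L)) L (IsCMField.complexConj L) 3 H).automorphicQuotient)
              [(adelicGroupData (↥(maximalRealSubfield L)) L (IsCMField.complexConj L) 3 H).IsAutomorphicMeasure μA],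
              ∀ P : DiscreteAutomorphicRep (adelicGroupData (↥(maximalRealSubfield L)) L (IsCMField.complexConj L) 3 H) μA,
                (P.IsHolCotangentAt (cmArchSection L ι H T hT) (cmCompactFactor L ι H T hT) ∨
                  P.IsAntiholCotangentAt (cmArchSection L ι H T hT) (cmCompactFactor L ι H T hT)) →
                ∀ (μ : Literature.NumberTheory.Automorphic.IdeleClassGroup L →ₜ* Circle) (hμ : IsConjugateSymplectic L μ), HasWeight L μ 1 →
                  ∀ (a : (↥(maximalRealSubfield L))ˣ) (χ : Chi (↥(maximalRealSubfield L)) L (IsCMField.complexConj L)),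
                    P.HasFinComponent
                      (rhoAtLine (↥(maximalRealSubfield L)) L (IsCMField.complexConj L) 3 e₁ (Matrix.diagonal dV)
                        (complexConj_imagUnit L) (imagUnit_ne_zero L) (imagUnit_mul_self L) (realDiagonal_isSymm L dV hdV)
                        (isUnit_det_realDiagonal L dV hdV hdV0) (realDiagonal_map L dV hdV).symm
                        (fun a => isCompatible_chiSplittingLine L e₁ dV hdV hdV0 (toHeckeCharacter L μ)
                          (isUnitary_toHeckeCharacter L μ) ((isOscillatorChar_toHeckeCharacter_iff μ).mpr hμ)
                          (TW (↥(maximalRealSubfield L)) a) (isSymm_TW (↥(maximalRealSubfield L)) a)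
                          (isUnit_det_TW (↥(maximalRealSubfield L)) a) (JW (↥(maximalRealSubfield L)) L a)
                          (JW_eq (↥(maximalRealSubfield L)) L a)) ιV a χ) →
                      Even ({v : HeightOneSpectrum (𝓞 ↥(maximalRealSubfield L)) |
                              locF (↥(maximalRealSubfield L)) (imagUnitSq L) a v ≠ 1}.ncard +
                        {φ : L →+* ℂ | φ ∈ hμ.cmType.1 ∧ 0 < (φ (2 * imagUnit L)⁻¹).im}.ncard)
    ) :
    Summit.HodgeConjecture.HodgeConjecture.Theses.HCCMUnconditional.F0HdictE := by
  delta Summit.HodgeConjecture.HodgeConjecture.Theses.HCCMUnconditional.F0HdictE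
    Summit.HodgeConjecture.HodgeConjecture.Theorems.F0FloorSockets.HdictEType
  exact
    oscillatorTriple_dictionaryExistence_holds_of TowerRealisation.stubU1RealisationAt_holds
      (P2StubU2OfLettersCadmD.stub_U2_cohFormsSpectrumIsThetaAt_of_Cadm_D
        (F0P2cSocketC.cohFinComponentIsThetaAdm_of_CE
          (F0P2eCEOfRung2.stubCE_of_PK_GL_LW_LR_LTpu hPK F0P2eStubGLGlobalLine.stubGL_holds F0P2eStubLWLocalWitness.stubLW_holds
            F0P2eStubLRLocalReindex.stubLR_holds F0P2eStubLTLocalTypeTransport.stubLT_prodUnique_holds))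
        F0P2dSocketD.holCotFormSpectralProjection_holds)
      (F0P2fE3OfRung2.stubU4_of_E3flat hE)

/-! ## §2  One rung up: socket 27455 and the crux from PKΠ and E3♭ -/

set_option synthInstance.maxHeartbeats 400000 in
set_option maxHeartbeats 16000000 in
/-- **`F0HdictE` FROM THE RUNG-3 ENGINE LETTER PKΠ (`F0P2PKRung3.StubPKPiPlacewiseMembership` = `F0P2PKPiRung4.PKPiTarget` VERBATIM) AND E3♭** — PK ⟸ PKΠ by ★ p816062
`F0P2gPKOfRung3.stubPK_of_PKPi` (NSI ★ p813978, KSP ★ p811895 inside).  The day A-p17 (g15)'s `F0P2jPKPiOfLetters.pkPi_of_letters hS2 hGR hD7 : ‹PKΠ›` is ★, `hPKPi` is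
that term (ED. 2). [cite: Rogawski1990, Thm 13.3.6 (c), §13.1 p. 199] [cite: GelbartRogawski1991, Lem 5.1.2 p. 466] [cite: Liu2021, Prop. 4.13 (Case 1), Rem. 4.14] -/
theorem hdictE_of_PKPi_E3flat
    (hPKPi :
      ∀ (L : Type) [Field L] [NumberField L] [IsCMField L] (ι : L →+* ℂ) (H : Matrix (Fin 3) (Fin 3) L) (T : GL (Fin 3) ℂ)
        (hT : (T : Matrix (Fin 3) (Fin 3) ℂ)ᴴ * H.map ι * (T : Matrix (Fin 3) (Fin 3) ℂ) = Literature.Geometry.ComplexHyperbolic.BallModel.J),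
        (∀ τ' : L →+* ℂ, InfinitePlace.mk τ' ≠ InfinitePlace.mk ι → (H.map τ').PosDef) → 2 ≤ Module.finrank ℚ ↥(maximalRealSubfield L) →
        ∀ {n' : ℕ} (e₁ : Fin 3 × Fin 1 ≃ Fin n') (dV : Fin 3 → L) (hdV : ∀ i, IsCMField.complexConj L (dV i) = dV i)
          (hdV0 : ∀ i, dV i ≠ 0) (g : GL (Fin 3) L)
          (hg : ((g : Matrix (Fin 3) (Fin 3) L).map (cmConjRingHom L))ᵀ * H * (g : Matrix (Fin 3) (Fin 3) L) = Matrix.diagonal dV)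
          (ιV : finAdelic (↥(maximalRealSubfield L)) L (IsCMField.complexConj L) 3 H →*
              finAdelic (↥(maximalRealSubfield L)) L (IsCMField.complexConj L) 3 (Matrix.diagonal dV)),
            (∀ k, ((ιV k : finAdelic (↥(maximalRealSubfield L)) L (IsCMField.complexConj L) 3 (Matrix.diagonal dV)) :
                GL (Fin 3) (FiniteAdeleRing (𝓞 L) L)) =
              (toFinAdeleGL L 3 g)⁻¹ * (k : GL (Fin 3) (FiniteAdeleRing (𝓞 L) L)) * toFinAdeleGL L 3 g) →
            ∀ (μ : Measure (adelicGroupData (↥(maximalRealSubfield L)) L (IsCMField.complexConj L) 3 H).automorphicQuotient)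
              [(adelicGroupData (↥(maximalRealSubfield L)) L (IsCMField.complexConj L) 3 H).IsAutomorphicMeasure μ]
              (W : Type) [AddCommGroup W] [Module ℂ W]
              (σ : Representation ℂ (finAdelic (↥(maximalRealSubfield L)) L (IsCMField.complexConj L) 3 H) W),
              σ.IsIrreducible → σ.IsSmooth → σ.IsAdmissible →
              ∀ P : DiscreteAutomorphicRep (adelicGroupData (↥(maximalRealSubfield L)) L (IsCMField.complexConj L) 3 H) μ,
                (P.IsHolCotangentAt (cmArchSection L ι H T hT) (cmCompactFactor L ι H T hT) ∨
                  P.IsAntiholCotangentAt (cmArchSection L ι H T hT) (cmCompactFactor L ι H T hT)) →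
                P.HasFinComponent σ →
                ∃ (μ : Literature.NumberTheory.Automorphic.IdeleClassGroup L →ₜ* Circle) (hμ : IsConjugateSymplectic L μ), HasWeight L μ 1 ∧
                  ∃ (χ : Chi (↥(maximalRealSubfield L)) L (IsCMField.complexConj L)),
                    ∀ (v : HeightOneSpectrum (𝓞 ↥(maximalRealSubfield L))), ∃ εv : (↥(maximalRealSubfield L))ˣ,
                        isotypicComponent (MonoidAlgebra ℂ (localPi L (IsCMField.complexConj L) 3 H v))
                          (Representation.asModule (σ.comp (inclPlace (↥(maximalRealSubfield L)) L (IsCMField.complexConj L) 3 H v)))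
                          (Representation.asModule
                            (((show Representation ℂ (localPi L (IsCMField.complexConj L) 3 (Matrix.diagonal dV) v) _ from
                              (TwistedCoinv.rep (localCharOfCenter (↥(maximalRealSubfield L)) L (IsCMField.complexConj L)
                                  (JW (↥(maximalRealSubfield L)) L εv) (JW_apply_ne_zero (↥(maximalRealSubfield L)) L εv) χ.1 v)
                                ((OmegaChiSplitting.chiLocalSplittingsD ⟨L⟩ e₁ dV hdV hdV0 (toHeckeCharacter L μ)
                                  ((isOscillatorChar_toHeckeCharacter_iff μ).mpr hμ) εv).omegaLoc v)
                                (commute_omegaLoc_localCenter (↥(maximalRealSubfield L)) L (IsCMField.complexConj L) 3 e₁ (Matrix.diagonal dV)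
                                  (JW (↥(maximalRealSubfield L)) L εv) (complexConj_imagUnit L) (imagUnit_ne_zero L) (imagUnit_mul_self L)
                                  (realDiagonal_isSymm L dV hdV) (isSymm_TW (↥(maximalRealSubfield L)) εv) (realDiagonal_map L dV hdV).symm
                                  (JW_eq (↥(maximalRealSubfield L)) L εv) (JW_apply_ne_zero (↥(maximalRealSubfield L)) L εv)
                                  (OmegaChiSplitting.chiLocalSplittingsD ⟨L⟩ e₁ dV hdV hdV0 (toHeckeCharacter L μ)
                                    ((isOscillatorChar_toHeckeCharacter_iff μ).mpr hμ) εv) v)).comp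
                                (UnitaryGroup.localLineInl L (IsCMField.complexConj L) 3 e₁ (Matrix.diagonal dV) (JW (↥(maximalRealSubfield L)) L εv) v)) :
                                localPi L (IsCMField.complexConj L) 3 (Matrix.diagonal dV) v →* _).comp
                              (localCongr L (IsCMField.complexConj L) g one_ne_zero
                                (F0P2cOmegaLocalType.formCongr_frame L H dV g hg) v).symm.toMulEquiv.toMonoidHom)) = ⊤
    )
    (hE :
      ∀ (L : Type) [Field L] [NumberField L] [IsCMField L] (ι : L →+* ℂ) (H : Matrix (Fin 3) (Fin 3) L) (T : GL (Fin 3) ℂ)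
        (hT : (T : Matrix (Fin 3) (Fin 3) ℂ)ᴴ * H.map ι * (T : Matrix (Fin 3) (Fin 3) ℂ) = Literature.Geometry.ComplexHyperbolic.BallModel.J),
        (∀ τ' : L →+* ℂ, InfinitePlace.mk τ' ≠ InfinitePlace.mk ι → (H.map τ').PosDef) → 2 ≤ Module.finrank ℚ ↥(maximalRealSubfield L) →
        ∀ {n' : ℕ} (e₁ : Fin 3 × Fin 1 ≃ Fin n') (dV : Fin 3 → L) (hdV : ∀ i, IsCMField.complexConj L (dV i) = dV i)
          (hdV0 : ∀ i, dV i ≠ 0) (g : GL (Fin 3) L)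
          (hg : ((g : Matrix (Fin 3) (Fin 3) L).map (cmConjRingHom L))ᵀ * H * (g : Matrix (Fin 3) (Fin 3) L) = Matrix.diagonal dV)
          (ιV : finAdelic (↥(maximalRealSubfield L)) L (IsCMField.complexConj L) 3 H →*
              finAdelic (↥(maximalRealSubfield L)) L (IsCMField.complexConj L) 3 (Matrix.diagonal dV)),
            (∀ k, ((ιV k : finAdelic (↥(maximalRealSubfield L)) L (IsCMField.complexConj L) 3 (Matrix.diagonal dV)) :
                GL (Fin 3) (FiniteAdeleRing (𝓞 L) L)) =
              (toFinAdeleGL L 3 g)⁻¹ * (k : GL (Fin 3) (FiniteAdeleRing (𝓞 L) L)) * toFinAdeleGL L 3 g) →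
            ∀ (μA : Measure (adelicGroupData (↥(maximalRealSubfield L)) L (IsCMField.complexConj L) 3 H).automorphicQuotient)
              [(adelicGroupData (↥(maximalRealSubfield L)) L (IsCMField.complexConj L) 3 H).IsAutomorphicMeasure μA],
              ∀ P : DiscreteAutomorphicRep (adelicGroupData (↥(maximalRealSubfield L)) L (IsCMField.complexConj L) 3 H) μA,
                (P.IsHolCotangentAt (cmArchSection L ι H T hT) (cmCompactFactor L ι H T hT) ∨
                  P.IsAntiholCotangentAt (cmArchSection L ι H T hT) (cmCompactFactor L ι H T hT)) →
                ∀ (μ : Literature.NumberTheory.Automorphic.IdeleClassGroup L →ₜ* Circle) (hμ : IsConjugateSymplectic L μ), HasWeight L μ 1 →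
                  ∀ (a : (↥(maximalRealSubfield L))ˣ) (χ : Chi (↥(maximalRealSubfield L)) L (IsCMField.complexConj L)),
                    P.HasFinComponent
                      (rhoAtLine (↥(maximalRealSubfield L)) L (IsCMField.complexConj L) 3 e₁ (Matrix.diagonal dV)
                        (complexConj_imagUnit L) (imagUnit_ne_zero L) (imagUnit_mul_self L) (realDiagonal_isSymm L dV hdV)
                        (isUnit_det_realDiagonal L dV hdV hdV0) (realDiagonal_map L dV hdV).symm
                        (fun a => isCompatible_chiSplittingLine L e₁ dV hdV hdV0 (toHeckeCharacter L μ)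
                          (isUnitary_toHeckeCharacter L μ) ((isOscillatorChar_toHeckeCharacter_iff μ).mpr hμ)
                          (TW (↥(maximalRealSubfield L)) a) (isSymm_TW (↥(maximalRealSubfield L)) a)
                          (isUnit_det_TW (↥(maximalRealSubfield L)) a) (JW (↥(maximalRealSubfield L)) L a)
                          (JW_eq (↥(maximalRealSubfield L)) L a)) ιV a χ) →
                      Even ({v : HeightOneSpectrum (𝓞 ↥(maximalRealSubfield L)) |
                              locF (↥(maximalRealSubfield L)) (imagUnitSq L) a v ≠ 1}.ncard +
                        {φ : L →+* ℂ | φ ∈ hμ.cmType.1 ∧ 0 < (φ (2 * imagUnit L)⁻¹).im}.ncard)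
    ) :
    Summit.HodgeConjecture.HodgeConjecture.Theses.HCCMUnconditional.F0HdictE :=
  hdictE_of_PK_E3flat (F0P2gPKOfRung3.stubPK_of_PKPi hPKPi) hE

set_option synthInstance.maxHeartbeats 400000 in
set_option maxHeartbeats 16000000 in
/-- **THE CRUX `HCCMUnconditional.H413` BY NAME MODULO EXACTLY {PKΠ, E3♭} ∪ {socket 27456 `F0HJ3a` (P3)}** — socket 27457 `F0Hocc` (P4) ★ discharged inside ★
`HCCMUnconditionalH413OfF0.H413_of_F0HdictE_F0HJ3a`.  HC_CM is proved only modulo the printed citations until rung 0 closes.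
[cite: Liu2021, Prop. 4.13, proof l. 2145] [cite: GelbartRogawski1991, Thm 5.1.1] [cite: Rogawski1990, Thm. 13.3.1, Thm 13.3.6 (c)] [cite: Li1992, Thm 2.1] -/
theorem H413_of_PKPi_E3flat
    (hPKPi :
      ∀ (L : Type) [Field L] [NumberField L] [IsCMField L] (ι : L →+* ℂ) (H : Matrix (Fin 3) (Fin 3) L) (T : GL (Fin 3) ℂ)
        (hT : (T : Matrix (Fin 3) (Fin 3) ℂ)ᴴ * H.map ι * (T : Matrix (Fin 3) (Fin 3) ℂ) = Literature.Geometry.ComplexHyperbolic.BallModel.J),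
        (∀ τ' : L →+* ℂ, InfinitePlace.mk τ' ≠ InfinitePlace.mk ι → (H.map τ').PosDef) → 2 ≤ Module.finrank ℚ ↥(maximalRealSubfield L) →
        ∀ {n' : ℕ} (e₁ : Fin 3 × Fin 1 ≃ Fin n') (dV : Fin 3 → L) (hdV : ∀ i, IsCMField.complexConj L (dV i) = dV i)
          (hdV0 : ∀ i, dV i ≠ 0) (g : GL (Fin 3) L)
          (hg : ((g : Matrix (Fin 3) (Fin 3) L).map (cmConjRingHom L))ᵀ * H * (g : Matrix (Fin 3) (Fin 3) L) = Matrix.diagonal dV)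
          (ιV : finAdelic (↥(maximalRealSubfield L)) L (IsCMField.complexConj L) 3 H →*
              finAdelic (↥(maximalRealSubfield L)) L (IsCMField.complexConj L) 3 (Matrix.diagonal dV)),
            (∀ k, ((ιV k : finAdelic (↥(maximalRealSubfield L)) L (IsCMField.complexConj L) 3 (Matrix.diagonal dV)) :
                GL (Fin 3) (FiniteAdeleRing (𝓞 L) L)) =
              (toFinAdeleGL L 3 g)⁻¹ * (k : GL (Fin 3) (FiniteAdeleRing (𝓞 L) L)) * toFinAdeleGL L 3 g) →
            ∀ (μ : Measure (adelicGroupData (↥(maximalRealSubfield L)) L (IsCMField.complexConj L) 3 H).automorphicQuotient)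
              [(adelicGroupData (↥(maximalRealSubfield L)) L (IsCMField.complexConj L) 3 H).IsAutomorphicMeasure μ]
              (W : Type) [AddCommGroup W] [Module ℂ W]
              (σ : Representation ℂ (finAdelic (↥(maximalRealSubfield L)) L (IsCMField.complexConj L) 3 H) W),
              σ.IsIrreducible → σ.IsSmooth → σ.IsAdmissible →
              ∀ P : DiscreteAutomorphicRep (adelicGroupData (↥(maximalRealSubfield L)) L (IsCMField.complexConj L) 3 H) μ,
                (P.IsHolCotangentAt (cmArchSection L ι H T hT) (cmCompactFactor L ι H T hT) ∨
                  P.IsAntiholCotangentAt (cmArchSection L ι H T hT) (cmCompactFactor L ι H T hT)) →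
                P.HasFinComponent σ →
                ∃ (μ : Literature.NumberTheory.Automorphic.IdeleClassGroup L →ₜ* Circle) (hμ : IsConjugateSymplectic L μ), HasWeight L μ 1 ∧
                  ∃ (χ : Chi (↥(maximalRealSubfield L)) L (IsCMField.complexConj L)),
                    ∀ (v : HeightOneSpectrum (𝓞 ↥(maximalRealSubfield L))), ∃ εv : (↥(maximalRealSubfield L))ˣ,
                        isotypicComponent (MonoidAlgebra ℂ (localPi L (IsCMField.complexConj L) 3 H v))
                          (Representation.asModule (σ.comp (inclPlace (↥(maximalRealSubfield L)) L (IsCMField.complexConj L) 3 H v)))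
                          (Representation.asModule
                            (((show Representation ℂ (localPi L (IsCMField.complexConj L) 3 (Matrix.diagonal dV) v) _ from
                              (TwistedCoinv.rep (localCharOfCenter (↥(maximalRealSubfield L)) L (IsCMField.complexConj L)
                                  (JW (↥(maximalRealSubfield L)) L εv) (JW_apply_ne_zero (↥(maximalRealSubfield L)) L εv) χ.1 v)
                                ((OmegaChiSplitting.chiLocalSplittingsD ⟨L⟩ e₁ dV hdV hdV0 (toHeckeCharacter L μ)
                                  ((isOscillatorChar_toHeckeCharacter_iff μ).mpr hμ) εv).omegaLoc v)
                                (commute_omegaLoc_localCenter (↥(maximalRealSubfield L)) L (IsCMField.complexConj L) 3 e₁ (Matrix.diagonal dV)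
                                  (JW (↥(maximalRealSubfield L)) L εv) (complexConj_imagUnit L) (imagUnit_ne_zero L) (imagUnit_mul_self L)
                                  (realDiagonal_isSymm L dV hdV) (isSymm_TW (↥(maximalRealSubfield L)) εv) (realDiagonal_map L dV hdV).symm
                                  (JW_eq (↥(maximalRealSubfield L)) L εv) (JW_apply_ne_zero (↥(maximalRealSubfield L)) L εv)
                                  (OmegaChiSplitting.chiLocalSplittingsD ⟨L⟩ e₁ dV hdV hdV0 (toHeckeCharacter L μ)
                                    ((isOscillatorChar_toHeckeCharacter_iff μ).mpr hμ) εv) v)).comp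
                                (UnitaryGroup.localLineInl L (IsCMField.complexConj L) 3 e₁ (Matrix.diagonal dV) (JW (↥(maximalRealSubfield L)) L εv) v)) :
                                localPi L (IsCMField.complexConj L) 3 (Matrix.diagonal dV) v →* _).comp
                              (localCongr L (IsCMField.complexConj L) g one_ne_zero
                                (F0P2cOmegaLocalType.formCongr_frame L H dV g hg) v).symm.toMulEquiv.toMonoidHom)) = ⊤
    )
    (hE :
      ∀ (L : Type) [Field L] [NumberField L] [IsCMField L] (ι : L →+* ℂ) (H : Matrix (Fin 3) (Fin 3) L) (T : GL (Fin 3) ℂ)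
        (hT : (T : Matrix (Fin 3) (Fin 3) ℂ)ᴴ * H.map ι * (T : Matrix (Fin 3) (Fin 3) ℂ) = Literature.Geometry.ComplexHyperbolic.BallModel.J),
        (∀ τ' : L →+* ℂ, InfinitePlace.mk τ' ≠ InfinitePlace.mk ι → (H.map τ').PosDef) → 2 ≤ Module.finrank ℚ ↥(maximalRealSubfield L) →
        ∀ {n' : ℕ} (e₁ : Fin 3 × Fin 1 ≃ Fin n') (dV : Fin 3 → L) (hdV : ∀ i, IsCMField.complexConj L (dV i) = dV i)
          (hdV0 : ∀ i, dV i ≠ 0) (g : GL (Fin 3) L)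
          (hg : ((g : Matrix (Fin 3) (Fin 3) L).map (cmConjRingHom L))ᵀ * H * (g : Matrix (Fin 3) (Fin 3) L) = Matrix.diagonal dV)
          (ιV : finAdelic (↥(maximalRealSubfield L)) L (IsCMField.complexConj L) 3 H →*
              finAdelic (↥(maximalRealSubfield L)) L (IsCMField.complexConj L) 3 (Matrix.diagonal dV)),
            (∀ k, ((ιV k : finAdelic (↥(maximalRealSubfield L)) L (IsCMField.complexConj L) 3 (Matrix.diagonal dV)) :
                GL (Fin 3) (FiniteAdeleRing (𝓞 L) L)) =
              (toFinAdeleGL L 3 g)⁻¹ * (k : GL (Fin 3) (FiniteAdeleRing (𝓞 L) L)) * toFinAdeleGL L 3 g) →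
            ∀ (μA : Measure (adelicGroupData (↥(maximalRealSubfield L)) L (IsCMField.complexConj L) 3 H).automorphicQuotient)
              [(adelicGroupData (↥(maximalRealSubfield L)) L (IsCMField.complexConj L) 3 H).IsAutomorphicMeasure μA],
              ∀ P : DiscreteAutomorphicRep (adelicGroupData (↥(maximalRealSubfield L)) L (IsCMField.complexConj L) 3 H) μA,
                (P.IsHolCotangentAt (cmArchSection L ι H T hT) (cmCompactFactor L ι H T hT) ∨
                  P.IsAntiholCotangentAt (cmArchSection L ι H T hT) (cmCompactFactor L ι H T hT)) →
                ∀ (μ : Literature.NumberTheory.Automorphic.IdeleClassGroup L →ₜ* Circle) (hμ : IsConjugateSymplectic L μ), HasWeight L μ 1 →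
                  ∀ (a : (↥(maximalRealSubfield L))ˣ) (χ : Chi (↥(maximalRealSubfield L)) L (IsCMField.complexConj L)),
                    P.HasFinComponent
                      (rhoAtLine (↥(maximalRealSubfield L)) L (IsCMField.complexConj L) 3 e₁ (Matrix.diagonal dV)
                        (complexConj_imagUnit L) (imagUnit_ne_zero L) (imagUnit_mul_self L) (realDiagonal_isSymm L dV hdV)
                        (isUnit_det_realDiagonal L dV hdV hdV0) (realDiagonal_map L dV hdV).symm
                        (fun a => isCompatible_chiSplittingLine L e₁ dV hdV hdV0 (toHeckeCharacter L μ)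
                          (isUnitary_toHeckeCharacter L μ) ((isOscillatorChar_toHeckeCharacter_iff μ).mpr hμ)
                          (TW (↥(maximalRealSubfield L)) a) (isSymm_TW (↥(maximalRealSubfield L)) a)
                          (isUnit_det_TW (↥(maximalRealSubfield L)) a) (JW (↥(maximalRealSubfield L)) L a)
                          (JW_eq (↥(maximalRealSubfield L)) L a)) ιV a χ) →
                      Even ({v : HeightOneSpectrum (𝓞 ↥(maximalRealSubfield L)) |
                              locF (↥(maximalRealSubfield L)) (imagUnitSq L) a v ≠ 1}.ncard +
                        {φ : L →+* ℂ | φ ∈ hμ.cmType.1 ∧ 0 < (φ (2 * imagUnit L)⁻¹).im}.ncard)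
    )
    (hJ3a : Summit.HodgeConjecture.HodgeConjecture.Theses.HCCMUnconditional.F0HJ3a) :
    Summit.HodgeConjecture.HodgeConjecture.Theses.HCCMUnconditional.H413 :=
  Summit.HodgeConjecture.HodgeConjecture.Theorems.HCCMUnconditionalH413OfF0.H413_of_F0HdictE_F0HJ3a
    (hdictE_of_PKPi_E3flat hPKPi hE) hJ3a

end Summit.HodgeConjecture.HodgeConjecture.Cruxes.H413.F0P2kHdictEOfLetters

end
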